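import Summits.QuantumFields.BalabanUV.T4Continuum.Support.MinimalActionMemClass
import Summits.QuantumFields.BalabanUV.T4Continuum.Support.NE3EnergyRateFlatClass
import HarnessLib

/-!
# T⁴ programme, node NE3 — THE FLAT DATUM OVER B11's CLASS (6) AS PRINTED: pure gauges lie in `ClassSix`, (H∃) AND the
# transport hypothesis (M2) are DISCHARGED at the flat datum, P2's ROOT T-E holds there, and the class-(6) route-(A) END
# `actionRate_classSix_thm1Type` (56S) is JOINTLY inhabited

NE3 formalisation swarm `b2b-balaban-t4-ne3-formalise-*`, LEAF PROVER 04 (unit `b2b-balaban-t4-ne3-formalise-leaf-04`,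
gen 3), support node «A-NV-joint» of `t4/formal/NE3/LEAVES.md` (typer ρ59), file 3: the class-(6) companion of
`Support/NE3EnergyRateFlatClass` (file 1) for the owner's re-cut `Support/MinimalActionMemClass` (p215998, (56S)), whose END
`actionRate_classSix_thm1Type` carries THREE typed hypotheses — (H∃) over `ClassSix` ([Balaban1985Variational] Thm 1 TYPE),
the transport (M2) = «the one-step average of a regular run-(k+1) minimiser, read on the next lattice, lies in (6) at level k»
([Balaban1985RegularSpaces] Prop. 3 ∕ [Balaban1985Averaging] (128)–(129) TYPE), and the regime — and no witness.

CONTENT (0 `def`, 0 `sorry`; kernel lane):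
* §1 `hol_gaugeAct_flatCfg_plaqWord` (pure gauges of `1` have trivial plaquettes), `regularSup_gaugeAct_flatCfg` (a pure
  gauge `1^{g}` with `g` unitary and `(N·L^k)`-periodic is `RegularSup d L N b c k` for all `b, c ≥ 0`),
  `gaugeAct_flatCfg_mem_classSix` (hence lies in `ClassSix d L N ε₀ k`, `ε₀ > 0`, via the crew's k-uniform
  `mem_classSix_of_regularSup`).
* §2 `isMinimiser_classSix_flatCfg` ((H∃) at the flat datum over (6): the flat configuration minimises every run),
  **`rescale_bavg_mem_classSix_of_isMinimiser_flatCfg`** ((M2) DISCHARGED at the flat datum: a run-(k+1) minimiser of the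
  flat datum in (6) is a periodic pure gauge `1^{g}` (file 1), its rescaled average is `1^{g∘(L•)}` ((45) BY NAME), again a
  periodic pure gauge, hence in (6) at level k).
* §3 **`ne3EnergyRate_classSix_flat`**: P2's ROOT T-E `NE3EnergyRate d (ClassSix d L N ε₀) L N b g C {flatCfg}` (file 1's
  `ne3EnergyRate_flatCfg_of_class`).
* §4 **`actionRate_classSix_thm1Type_flat`**: the (56S) END instantiated at `dom = {flatCfg}`, corner `b = c = t = B = C = 0`
  — ALL its hypotheses ((H∃), (M2), regime) inhabited at once: `ActionRate (minActReadings d (ClassSix d L N ε₀) L N {flatCfg}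
  loc) (wallConstNA(d,L)(gradConst d 1 + 1)/L²) (L⁻²)` for every `d ≥ 1`, `L ≥ 1`, `N ≥ 1`, `ε₀ > 0` and every reading `loc`.

HONEST FRAMING.  NON-VACUITY at the FLAT datum only (every constrained minimiser is a periodic pure gauge); nothing about
Bałaban's minimisers at a non-flat datum; (M2) at a non-flat datum remains the typed B8 Prop. 3 hypothesis (the skeleton's
risk (r3), crew row S3-D7); NE3 is NOT proved; (H∃) and T-E remain HYPOTHESES; no estimate of the cell is touched; no
conditional of the cell (`BetaPertH`, (B), (B^μ), G-an2-4) is used or hidden; nothing printed is a hypothesis of a theorem;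
no `def`, no `sorry`, axioms ⊆ {propext, Classical.choice, Quot.sound}.  Finite T⁴ rung (B)+1 — NOT infinite volume, NOT a
mass gap, NOT the Clay problem, NOT summit progress.  PLACEMENT: `Summits/QuantumFields/BalabanUV/`.  HONEST DEPENDENCY
(cell page 1): continuum YM on T⁴ ⇐ BetaPertH ∧ nine spine estimates (0/9 proved); BetaPertH ⇐ (D1) ∧ (D4) ∧ CAP+tail;
G-an2-4 gates asym, D1 and NE2/3/4.
-/

set_option autoImplicit false

open scoped BigOperators Matrix Matrix.Norms.L2Operator
open NormedSpace Finset

namespace Summit.QuantumFields.BalabanUV.T4Continuum.NE3ClassSixFlatWitness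

open Literature.MathematicalPhysics.QuantumFieldTheory.Balaban1983to89
open B7Prop1Explicit B7Prop2Explicit MatrixLog UnitaryModel
open T4AveragingDeficitWall hiding Site Plane Plaq Bond
open T4AveragingDeficitWallBoundary (IsPeriodicCfg periodBox)
open T4AveragingDeficitNonAbelian (wallConstNA)
open T4EtaRateMin (ActionRate)
open B7AvgGaugeCovariance (uLev uLev_apply)
open MinimalActionLevels (levelAction levelAction_nonneg)
open MinimalActionSandwich (IsMinimiser admissible)
open MinimalActionRate (sfClass minActReadings)
open MinimalActionRefine (RegularSup regularSup_flatCfg gradConst)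
open MinimalActionWitness (flatCfg avgIter_flatCfg levelAction_flatCfg)
open MinimalActionClassSix (ClassSix classSix_subset_sfClass flatCfg_mem_classSix mem_classSix_of_regularSup)
open MinimalActionMemClass (actionRate_classSix_thm1Type)
open SkeletonPrecompGrad (gradRem)
open NE3EnergyShapes (NE3EnergyRate IsPeriodicSite)
open NE3EnergyRateFlatClass (ne3EnergyRate_flatCfg_of_class exists_periodic_gauge_of_isMinimiser_flatCfg
  avgIter_gaugeAct_flatCfg)

noncomputable section

variable {d : ℕ} {n : Type*} [Fintype n] [DecidableEq n]

/-! ## §1 Periodic pure gauges of `1` are regular and lie in class (6) -/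

/-- A pure gauge of the flat configuration has trivial plaquette variables: `(1^{g})(∂p) = g(x)·1·g(x)⁻¹ = 1`.
[folklore] -/
theorem hol_gaugeAct_flatCfg_plaqWord (g : Site d → (Matrix n n ℂ)ˣ) (x : Site d) (κ μ : Fin d) :
    hol (gaugeAct g (flatCfg : Site d → Fin d → (Matrix n n ℂ)ˣ)) x (plaqWord κ μ) = 1 := by
  rw [hol_gaugeAct_closed g flatCfg x _ (disp_plaqWord κ μ)]
  unfold flatCfg
  rw [hol_flat, mul_one, mul_inv_cancel]

/-- … in the tree's `fhol` reading. [folklore] -/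
theorem fhol_gaugeAct_flatCfg (g : Site d → (Matrix n n ℂ)ˣ) (p : T4AveragingDeficitWall.Plaq d) :
    fhol (gaugeAct g (flatCfg : Site d → Fin d → (Matrix n n ℂ)ˣ)) p = 1 :=
  hol_gaugeAct_flatCfg_plaqWord g p.1 _ _

/-- **A PERIODIC PURE GAUGE OF `1` IS REGULAR**: for `g` unitary and `(N·L^k)`-periodic, `1^{g}` is `RegularSup d L N b c k`
for all `b, c ≥ 0` (unitary, periodic, plaquettes `1`, flux `0`, flux gradient `0`). [folklore] -/
theorem regularSup_gaugeAct_flatCfg {L N k : ℕ} {g : Site d → (Matrix n n ℂ)ˣ}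
    (hg : ∀ x, g x ∈ unitaryUnits (Matrix n n ℂ)) (hper : IsPeriodicSite g ((N * L ^ k : ℕ) : ℤ))
    {b c : ℝ} (hb : 0 ≤ b) (hc : 0 ≤ c) :
    RegularSup d L N b c k (gaugeAct g (flatCfg : Site d → Fin d → (Matrix n n ℂ)ˣ)) where
  unitary := fun x κ =>
    (unitaryUnits (Matrix n n ℂ)).mul_mem
      ((unitaryUnits (Matrix n n ℂ)).mul_mem (hg x) (by unfold flatCfg; exact (unitaryUnits (Matrix n n ℂ)).one_mem))
      ((unitaryUnits (Matrix n n ℂ)).inv_mem (hg _))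
  periodic := fun x i μ => by
    simp only [gaugeAct, flatCfg]
    rw [add_right_comm, hper x i, hper (x + e μ) i]
  small := fun x κ κ' _ => by
    rw [hol_gaugeAct_flatCfg_plaqWord, Units.val_one, sub_self, norm_zero]
    positivity
  grad := fun x κ π => by
    have h0 : covGrad (gaugeAct g (flatCfg : Site d → Fin d → (Matrix n n ℂ)ˣ)) (flux (gaugeAct g flatCfg)) x κ π = 0 := by
      unfold covGrad flux
      rw [fhol_gaugeAct_flatCfg, fhol_gaugeAct_flatCfg, Units.val_one, mlog_one]
      simp [Ad]
    rw [h0, norm_zero]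
    positivity

/-- **PERIODIC PURE GAUGES OF `1` LIE IN CLASS (6)** (`ε₀ > 0`, `L ≥ 1`): plaquettes `1` and currents `0` — through the
crew's k-uniform `mem_classSix_of_regularSup` at radii `(0, 0)`. [folklore] -/
theorem gaugeAct_flatCfg_mem_classSix [Nonempty n] {L N k : ℕ} (hL : 1 ≤ L) {ε₀ : ℝ} (hε : 0 < ε₀)
    {g : Site d → (Matrix n n ℂ)ˣ} (hg : ∀ x, g x ∈ unitaryUnits (Matrix n n ℂ))
    (hper : IsPeriodicSite g ((N * L ^ k : ℕ) : ℤ)) :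
    gaugeAct g (flatCfg : Site d → Fin d → (Matrix n n ℂ)ˣ) ∈ ClassSix (n := n) d L N ε₀ k :=
  mem_classSix_of_regularSup hL le_rfl (by norm_num) hε (by simpa using hε) (regularSup_gaugeAct_flatCfg hg hper le_rfl le_rfl)

/-! ## §2 (H∃) and (M2) at the flat datum over class (6) -/

/-- **(H∃) AT THE FLAT DATUM OVER (6)**: the flat configuration minimises every run of the flat datum in `ClassSix ε₀`
(`ε₀ > 0`; its action is `0`, every `U(N)`-valued action is `≥ 0`). [folklore] -/
theorem isMinimiser_classSix_flatCfg [Nonempty n] {L : ℕ} (hL : 1 ≤ L) (N : ℕ) {ε₀ : ℝ} (hε : 0 < ε₀) (k : ℕ) :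
    IsMinimiser d (ClassSix (n := n) d L N ε₀) L N k flatCfg flatCfg where
  mem := ⟨flatCfg_mem_classSix hL N hε k, avgIter_flatCfg L k⟩
  le := fun _ hU' => by
    rw [levelAction_flatCfg]
    exact levelAction_nonneg L N k hL (classSix_subset_sfClass d L N ε₀ k hU'.1).1

/-- **(M2) DISCHARGED AT THE FLAT DATUM**: a run-`(k+1)` minimiser `U` of the flat datum in `ClassSix ε₀` is a periodic pure
gauge `1^{g}` (file 1: zero action ⇒ zero curvature ⇒ pure gauge, the constraint kills the cycle holonomies), so its
rescaled one-step average `rescale L (bavg L U) = 1^{g∘(L•)}` ((45) BY NAME) is again a periodic pure gauge and lies in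
`ClassSix ε₀` at level `k` (`L, N ≥ 1`, `ε₀ > 0`). [folklore] -/
theorem rescale_bavg_mem_classSix_of_isMinimiser_flatCfg [Nonempty n] {L N : ℕ} (hL : 1 ≤ L) (hN : 1 ≤ N) {ε₀ : ℝ}
    (hε : 0 < ε₀) {k : ℕ} {U : Site d → Fin d → (Matrix n n ℂ)ˣ}
    (hU : IsMinimiser d (ClassSix (n := n) d L N ε₀) L N (k + 1) flatCfg U) :
    rescale L (bavg L U) ∈ ClassSix (n := n) d L N ε₀ k := by
  obtain ⟨g, hgu, hgp, hUg⟩ := exists_periodic_gauge_of_isMinimiser_flatCfg hL hN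
    (fun _ hU' => ⟨(classSix_subset_sfClass d L N ε₀ (k + 1) hU').1, (classSix_subset_sfClass d L N ε₀ (k + 1) hU').2.1⟩)
    (flatCfg_mem_classSix hL N hε (k + 1)) hU
  have hW : rescale L (bavg L U) = gaugeAct (uLev L g 1) flatCfg := by
    have h := avgIter_gaugeAct_flatCfg L g 1
    rw [← hUg] at h
    exact h
  rw [hW]
  refine gaugeAct_flatCfg_mem_classSix hL hε (fun x => hgu _) (fun x i => ?_)
  simp only [uLev_apply, pow_one, smul_add, smul_smul]
  have hcast : (L : ℤ) * ((N * L ^ k : ℕ) : ℤ) = ((N * L ^ (k + 1) : ℕ) : ℤ) := by push_cast; ring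
  rw [hcast, hgp]

/-! ## §3 P2's ROOT T-E for the flat datum over class (6) -/

/-- **T-E FOR THE FLAT DATUM OVER CLASS (6)**: `NE3EnergyRate d (ClassSix d L N ε₀) L N b g C {flatCfg}` for `L, N ≥ 1`,
`ε₀ > 0`, all `b, g`, every `C ≥ 0` (file 1's `ne3EnergyRate_flatCfg_of_class`: (6) consists of periodic `U(N)`
configurations and contains `1`). NE3 is NOT proved by it. [folklore] -/
theorem ne3EnergyRate_classSix_flat [Nonempty n] {L N : ℕ} (hL : 1 ≤ L) (hN : 1 ≤ N) {ε₀ : ℝ} (hε : 0 < ε₀) (b g : ℝ)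
    {C : ℝ} (hC : 0 ≤ C) :
    NE3EnergyRate d (ClassSix (n := n) d L N ε₀) L N b g C {flatCfg} :=
  ne3EnergyRate_flatCfg_of_class hL hN
    (fun k _ hU => ⟨(classSix_subset_sfClass d L N ε₀ k hU).1, (classSix_subset_sfClass d L N ε₀ k hU).2.1⟩)
    (fun k => flatCfg_mem_classSix hL N hε k) b g hC

/-! ## §4 The class-(6) END of route (A) is jointly inhabited -/

/-- **JOINT NON-VACUITY OF `actionRate_classSix_thm1Type` ((56S))**: at the flat datum (`dom = {flatCfg}`) and the corner
`b = c = t = B = C = 0` of its regime, ALL its hypotheses hold at once — (H∃) by `isMinimiser_classSix_flatCfg` +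
`regularSup_flatCfg`, (M2) by `rescale_bavg_mem_classSix_of_isMinimiser_flatCfg` (DISCHARGED, not assumed), the thresholds
trivially — so `ActionRate (minActReadings d (ClassSix d L N ε₀) L N {flatCfg} loc) (wallConstNA(d,L)(gradConst d 1 + 1)/L²)
(L⁻²)` for every `d, L, N ≥ 1`, `ε₀ > 0` and every local reading `loc`.  Non-vacuity only; NE3 NOT proved. [folklore] -/
theorem actionRate_classSix_thm1Type_flat [Nonempty n] (hd : 1 ≤ d) {L N : ℕ} (hL : 1 ≤ L) (hN : 1 ≤ N) {ε₀ : ℝ}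
    (hε : 0 < ε₀) {X : Type*} (loc : ℕ → (Site d → Fin d → (Matrix n n ℂ)ˣ) → X → ℝ) :
    ActionRate (minActReadings d (ClassSix (n := n) d L N ε₀) L N {(flatCfg : Site d → Fin d → (Matrix n n ℂ)ˣ)} loc)
      (wallConstNA d L * (gradConst d 1 + 1) / (L : ℝ) ^ 2) (((L : ℝ) ^ 2)⁻¹) :=
  actionRate_classSix_thm1Type hd hL hN (b := 0) (c := 0) (t := 0) (B := 0) (C := 0) le_rfl le_rfl le_rfl le_rfl le_rfl
    (by norm_num) hε (by simpa using hε) (by norm_num)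
    (by rw [mul_zero]; exact zero_le_one) (by rw [mul_zero]; exact zero_le_one) (by rw [mul_zero]; exact zero_le_one)
    (by rw [mul_zero]) (by rw [mul_zero])
    (fun V hV k => by
      rw [Set.mem_singleton_iff] at hV
      subst hV
      exact ⟨flatCfg, isMinimiser_classSix_flatCfg hL N hε k, regularSup_flatCfg L N k le_rfl le_rfl⟩)
    (fun V hV k _ hU _ => by
      rw [Set.mem_singleton_iff] at hV
      subst hV
      exact rescale_bavg_mem_classSix_of_isMinimiser_flatCfg hL hN hε hU)
    loc

end

end Summit.QuantumFields.BalabanUV.T4Continuum.NE3ClassSixFlatWitness
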